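import Summits.QuantumFields.YangMills.Theorems.BalabanUVNodesK0SingleBondResponse
import Literature.MathematicalPhysics.QuantumFieldTheory.Balaban1983to89.T4StabilityFloorUnitary

/-!
# K0⁗ ROW P11 — part D: ★★ THE FLOOR OF RECORD `VariationalThm1RegSepPrinted F N B₃ a₀ a₁ → 2L² ≤ B₃`

Cell `pub-ymgap`, seat `pub-ymgap-dag-n21-c` g7 (R134 (a) N21 NE7c s1; K0⁗ ROW P11 negative side; INBOX INTENT-2 of 2026-08-27 ≈07:40Z; dag-n07-e g7 l.17651 «NO STOP —
19b uses ONLY the crude global bound … your sharp `dist1_avgFun_singleBond_le` is NEW and needed»).  Filed `--kind proof --supports stmt-QuantumFields-20289 --as helper`.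
[15] = [Balaban1985Variational]; [I] = [Balaban1987RG1]; [III] = [Balaban1988Convergent]; [B7] = [Balaban1985Averaging].

THE SERIES (four modules, one namespace `…Theorems.K0AveragedSingleBondFloor`): (A) `…K0SingleBondWalks` — walk bookkeeping and «Ū = 1 by avoidance ∕ by locality»;
(B) `…K0SingleBondStarLoops` — the loop variables of [I] (0.4) at the one coarse bond `c⋆` the twisted fine bond crosses, and the printed `exp[mean log]` of a two-valued
family; (C) `…K0SingleBondResponse` — THE IMPULSE RESPONSE of Bałaban's (0.4) averaging of record (`avOfRecord = blockAvg expMeanLogSU`) to ONE twisted fine bond: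
`|Ū(c⋆) − 1| ≤ exp(−log(1−t)∕L^{d−1}) − 1 ≤ 4t∕L³`, `Ū(c) = 1` for every other coarse bond; (D) `…K0AveragedSingleBondFloor` — ★★ THE FLOOR OF RECORD for node00-def-P11's
FILE 8 v1.3 fact: `VariationalThm1RegSepPrinted F N B₃ a₀ a₁ → 2L² ≤ B₃` (every `N ≥ 2`, `a₀, a₁ > 0`), unconditionally (existence by dag-n07-e 19a's small-action boundary avoidance).
HONEST FRAMING: kernel bookkeeping about the TREE's own averaging and one certificate about a TREE-typed fact; nothing of Bałaban asserted or refuted (print: `B₃ = B₃(d, L)`;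
node00-def-K0a displays `2L² ≤ B₃`); K0⁗ neither discharged nor refuted; counts unmoved; no `def`, no `sorry`, no `instance`.

THIS MODULE (D).  §8 ★★ `two_sq_L_le_of_variationalThm1RegSepPrinted` (docstring there: the separated one-cube index of p498335, its corner plaquette, dag-n07-e 19a's
single-bond datum on the bond ENTERING `Ω₁`, data `W := M_𝐁(U₁)`, thresholds `δ₀ := 2δ₁`, `t := max(B₃,1)·δ₁∕L² < δ₀`; (7)-v1.3 holds at level 0 (`t < δ₀`) and at
level 1 by part C (`16t∕L³ < δ₁`); existence by `exists_isMinimizer_holes_of_smallAction`; the fact's bound `B₃δ₁∕L²` at the pinned corner `g⁻¹` of size `t ≥ B₃δ₁∕L²` is the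
contradiction) + `not_variationalThm1RegSepPrinted_of_lt_two_sq` + §9 `variationalThm1RegSepPrinted_degenerate_of_lt_two_sq`.
WHAT THIS MEANS FOR THE K0 LANE (numbers): FILE 8's three facts at `N ≥ 2`, `a₀, a₁ > 0`: v1.0 `…Mixed` and v1.2 `…Outer` UNINHABITED for every `B₃`; v1.3 `…Printed`
uninhabited for every `B₃ < 2L²` (`L ≥ 13`: `B₃ < 338`), untouched for `B₃ ≥ 2L²` — consistent with print's `B₃ = B₃(d, L)` and with node00-def-K0a's displayed floor.
DEPENDENCES (by name): parts A–C; dag-n07-e 19a `N07SmallActionBoundaryAvoidance.(exists_isMinimizer_holes_of_smallAction, wilsonAction4_le_card_mul_sq, cornerPlaq_bonds_mem_bondsOf,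
plaqHol_single_corner, mixedField_avg_self)`; p498335 `(exists_seq_singleCube, cover_zero_mem_cubeEnl_zero, cover_notMem_cubeEnl_zero, lt_sitesPerDir_zero, eta_one_sq)`; p488412 `shift_cover`;
p505245 `exists_su_dist1_eq`; p510186 `plaqHol_eq_of_agreeOn_of_bonds`; FILE 8 v1.3 `Sect2.DataSmall7P`, `VariationalThm1RegSepPrinted`; `Node00.numerics7OfRecord₁₂`; dag-n07-e 17a
`N07Thm1ScaledInterfaceInstance.dist1_plaqHol_single_le`; `T4StabilityFloorUnitary.dist1_plaqHol_le_four_mul`.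
-/

noncomputable section

open scoped Matrix.Norms.L2Operator

namespace Summit.QuantumFields.YangMills.Theorems.K0AveragedSingleBondFloor

open Literature.MathematicalPhysics.QuantumFieldTheory.Balaban1983to89
open Literature.MathematicalPhysics.QuantumFieldTheory.Balaban1983to89.Node00
open Literature.MathematicalPhysics.QuantumFieldTheory.Balaban1983to89.T4Continuum
open B15DeterminingSets BlockAveraging
open Literature.MathematicalPhysics.QuantumFieldTheory.Balaban1983to89.T3DescentFibreTower (holAt_one axialAvg_one avgFun_one
  expMeanLogSU_E_one loopHol_one small_one)
/-! ## §8  ★★ THE FLOOR OF RECORD FOR FILE 8 v1.3's FACT: `VariationalThm1RegSepPrinted F N B₃ a₀ a₁ → 2L² ≤ B₃` -/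
section Floor

open ExpMeanLog (deltaSU expMeanLogSU deltaSU_pos lt_third_of_lt_deltaSU)
open B15Eq112TorusCover
open Summit.QuantumFields.YangMills.Theorems.K0BgProvisoOverRange (shift_cover)
open Summit.QuantumFields.YangMills.Theorems.K0VariationalThm1ScaledCorner (cover_zero_mem_cubeEnl_zero cover_notMem_cubeEnl_zero
  exists_seq_singleCube lt_sitesPerDir_zero eta_one_sq)
open Summit.QuantumFields.YangMills.Theorems.K0VariationalThm1DatumCoupling (exists_su_dist1_eq)
open Summit.QuantumFields.YangMills.Theorems.K0VariationalThm1OuterRange (plaqHol_eq_of_agreeOn_of_bonds)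
open Summit.QuantumFields.YangMills.BalabanUVNodes.N07SmallActionBoundaryAvoidance (cornerPlaq_bonds_mem_bondsOf plaqHol_single_corner
  mixedField_avg_self wilsonAction4_le_card_mul_sq exists_isMinimizer_holes_of_smallAction)
open Summit.QuantumFields.YangMills.BalabanUVNodes.N07Thm1ScaledInterfaceInstance (dist1_plaqHol_single_le)
open Literature.MathematicalPhysics.QuantumFieldTheory.Balaban1983to89.T4StabilityFloorUnitary (dist1_plaqHol_le_four_mul)

variable {F : T4Family} {N : ℕ} [NeZero N]

/-- **★★ THE FLOOR OF RECORD: `VariationalThm1RegSepPrinted F N B₃ a₀ a₁ → 2L² ≤ B₃`** (every `N ≥ 2`, `0 < a₀`, `0 < a₁`), UNCONDITIONALLY.  On `F.P 1`: the separated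
one-cube index of p498335 (`k = 1`, `Ω₁ = Λ₁ = B(0)`), its corner plaquette `p = ⟨π(−1,−1,0,0); 0, 1⟩`, dag-n07-e 19a's single-bond datum `U₁` twisted by `g` (`|g − 1| = t`) on the
bond `⟨π(−1,0,0,0), 0⟩` ENTERING `Ω₁` at `π(0)`, data `W := M_𝐁(U₁)`; `δ₀ := 2δ₁`, `t := max(B₃,1)·δ₁∕L² < δ₀` (here `B₃ < 2L²` enters), `δ₁` small.  (7)-v1.3 holds: level 0 since
every fine plaquette of `U₁` is within `t < δ₀`; level 1 since the (0.4) averaging of record moves ONE coarse bond by `≤ 4t∕L³` and no other (part C), so coarse plaquettes are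
within `16t∕L³ < δ₁`.  `U₁` is in the `ε₀`-class with action below one boundary plaquette ⇒ an open-class minimiser `U₀` EXISTS (19a); the fact bounds `U₀`'s corner plaquette by
`B₃δ₁∕L²`, the fibre pins it to `g⁻¹` of size `t ≥ B₃δ₁∕L²` — contradiction.  So node00-def-K0a's displayed `2L² ≤ B₃` is NECESSARY for the v1.3 fact (print: `B₃ = B₃(d, L)`).
[cite: Balaban1985Variational, Thm 1 (7)–(8) pp.278–279; Balaban1987RG1, (0.4) p.253; Balaban1988Convergent, (2.2) p.255, (2.10)–(2.12) p.256 (bookkeeping)] -/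
theorem two_sq_L_le_of_variationalThm1RegSepPrinted (hN : 2 ≤ N) {B₃ a₀ a₁ : ℝ} (ha₀ : 0 < a₀) (ha₁ : 0 < a₁)
    (h : VariationalThm1RegSepPrinted F N B₃ a₀ a₁) : 2 * (F.L : ℝ) ^ 2 ≤ B₃ := by
  classical
  by_contra hB
  rw [not_le] at hB
  -- the torus `F.P 1`
  set P : Params := F.P 1 with hPdef
  have hPL : P.L = F.L := T4Family.P_L F 1
  have hPd : P.d = 4 := T4Family.P_d F 1
  have hL11 : 11 < F.L := F.hL11
  have hLR : (12 : ℝ) ≤ F.L := by exact_mod_cast (show 12 ≤ F.L by omega)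
  have hL1 : (1 : ℝ) ≤ F.L := by linarith only [hLR]
  have hLpos : (0 : ℝ) < F.L := by linarith only [hLR]
  have hL2pos : (0 : ℝ) < (F.L : ℝ) ^ 2 := by positivity
  have hL2ge : (1 : ℝ) ≤ (F.L : ℝ) ^ 2 := one_le_pow₀ hL1
  have hL3pos : (0 : ℝ) < (F.L : ℝ) ^ 3 := by positivity
  have hL3ge : (32 : ℝ) ≤ (F.L : ℝ) ^ 3 := by
    have h12 : (12 : ℝ) ^ 3 ≤ (F.L : ℝ) ^ 3 := pow_le_pow_left₀ (by norm_num) hLR 3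
    norm_num at h12
    linarith only [h12]
  have hsites : P.sitesPerDir 0 = 2 * F.L ^ (F.m + 1) := T4Family.sitesPerDir_eq F 1
  have hper2 : 2 * P.L < P.sitesPerDir 0 := by
    rw [hsites, hPL]
    have : F.L < F.L ^ (F.m + 1) := by
      calc F.L = F.L ^ 1 := (pow_one _).symm
        _ < F.L ^ (F.m + 1) := Nat.pow_lt_pow_right (by omega) (by have := F.hm; omega)
    omega
  have hperL : F.L < P.sitesPerDir 0 := lt_sitesPerDir_zero F 1
  have hL3 : 3 ≤ P.L := by rw [hPL]; omega
  have hj : 0 + 1 ≤ P.m + P.K := by show 0 + 1 ≤ F.m + 1; omega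
  -- directions `μ₀ = 0 < ν₁ = 1`
  set μ0 : Fin P.d := ⟨0, by rw [hPd]; norm_num⟩ with hμ0
  set ν₁ : Fin P.d := ⟨1, by rw [hPd]; norm_num⟩ with hν₁
  have hne : ν₁ ≠ μ0 := by intro h'; have := congrArg Fin.val h'; simp [hμ0, hν₁] at this
  have hμν : μ0 < ν₁ := Fin.mk_lt_mk.2 (by norm_num)
  -- the corner plaquette `p = ⟨π(−1,−1,0,0); 0, 1⟩`, the twisted bond `⟨x′, 0⟩`, `x′ = π(−1,0,0,0)`, the neighbouring block `y₁ = −e₀`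
  set w₀ : Fin P.d → ℤ := fun i => if i = μ0 ∨ i = ν₁ then -1 else 0 with hw₀
  have hw₀μ : w₀ μ0 = -1 := by simp [hw₀]
  have hw₀ν : w₀ ν₁ = -1 := by simp [hw₀]
  set p : Plaq P 0 := ⟨cover P w₀, μ0, ν₁, hμν⟩ with hp
  set x' : Site P 0 := p.src.shift p.ν with hx'
  set y₁ : Site P 1 := (0 : Site P 1).unshift μ0 with hy₁
  set hh : ℕ := (P.L - 1) / 2 with hhh
  have hL2 : 2 * hh + 1 = P.L := AveragingRT.two_mul_half_add_one P
  -- coordinates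
  have hx'κ : ∀ κ, x' κ = if κ = ν₁ then 0 else ((w₀ κ : ℤ) : ZMod (P.sitesPerDir 0)) := by
    intro κ
    show ((cover P w₀).shift ν₁) κ = _
    rw [Site.shift_apply, cover_apply, cover_apply]
    by_cases hκ : κ = ν₁
    · rw [if_pos hκ, if_pos hκ, hw₀ν]; push_cast; ring
    · rw [if_neg hκ, if_neg hκ]
  have hemb0 : ∀ κ, emb (0 : Site P 1) κ = ((hh : ℕ) : ZMod (P.sitesPerDir 0)) := by
    intro κ
    show (((((0 : Site P 1) κ).val * P.L + (P.L - 1) / 2 : ℕ)) : ZMod (P.sitesPerDir 0)) = _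
    rw [Site.zero_apply, ZMod.val_zero, zero_mul, zero_add]
  have hemby : ∀ κ, emb y₁ κ = ((hh : ℕ) : ZMod (P.sitesPerDir 0)) - (if κ = μ0 then (P.L : ZMod (P.sitesPerDir 0)) else 0) := by
    intro κ
    have h1 := emb_shift_apply y₁ μ0 κ
    rw [show y₁.shift μ0 = 0 from Site.shift_unshift 0 μ0, hemb0] at h1
    rw [h1]; ring
  have hx0 : x' μ0 = emb y₁ μ0 + ((hh : ℕ) : ZMod (P.sitesPerDir 0)) := by
    rw [hx'κ, if_neg (Ne.symm hne), hw₀μ, hemby, if_pos rfl]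
    have hc : ((P.L : ℕ) : ZMod (P.sitesPerDir 0)) = 2 * ((hh : ℕ) : ZMod (P.sitesPerDir 0)) + 1 := by
      rw [← hL2]; push_cast; ring
    rw [hc]; push_cast; ring
  have hxκ : ∀ κ, κ ≠ μ0 → x' κ + ((hh : ℕ) : ZMod (P.sitesPerDir 0)) = emb y₁ κ := by
    intro κ hκ
    rw [hx'κ, hemby, if_neg hκ, sub_zero]
    by_cases hκ' : κ = ν₁
    · rw [if_pos hκ', zero_add]
    · rw [if_neg hκ']
      have : w₀ κ = 0 := by simp [hw₀, hκ, hκ']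
      rw [this]; push_cast; ring
  -- the index `k = 1`, `Ω₁ = B(0)`
  obtain ⟨s, hsΩ, hsep⟩ := exists_seq_singleCube F numerics7OfRecord₁₂ 1
  have hsΩ' : s.Ω 1 = cubeEnl P P.L 0 0 := by rw [hsΩ, hPL]
  -- the three near corners are off `Ω₁`, the far corner `π(0)` is in it
  have h1 : p.src ∉ s.Ω 1 := by rw [hsΩ']; exact cover_notMem_cubeEnl_zero (by rw [hPL]; exact hperL) w₀ hw₀μ
  have h2 : p.src.shift p.μ ∉ s.Ω 1 := by
    rw [hsΩ']; show (cover P w₀).shift μ0 ∉ _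
    rw [shift_cover]
    exact cover_notMem_cubeEnl_zero (by rw [hPL]; exact hperL) _ (i := ν₁) (by rw [Function.update_of_ne hne, hw₀ν])
  have h3 : p.src.shift p.ν ∉ s.Ω 1 := by
    rw [hsΩ']; show (cover P w₀).shift ν₁ ∉ _
    rw [shift_cover]
    exact cover_notMem_cubeEnl_zero (by rw [hPL]; exact hperL) _ (i := μ0) (by rw [Function.update_of_ne (Ne.symm hne), hw₀μ])
  have hfar : (p.src.shift p.μ).shift p.ν ∈ s.Ω 1 := by
    rw [hsΩ']; show ((cover P w₀).shift μ0).shift ν₁ ∈ _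
    rw [shift_cover, shift_cover]
    have h0 : Function.update (Function.update w₀ μ0 (w₀ μ0 + 1)) ν₁ (Function.update w₀ μ0 (w₀ μ0 + 1) ν₁ + 1) = 0 := by
      funext i
      by_cases hiν : i = ν₁
      · subst hiν; rw [Function.update_self, Function.update_of_ne hne, hw₀ν]; norm_num
      · rw [Function.update_of_ne hiν]
        by_cases hiμ : i = μ0
        · subst hiμ; rw [Function.update_self, hw₀μ]; norm_num
        · rw [Function.update_of_ne hiμ]; simp [hw₀, hiμ, hiν]
    rw [h0]
    exact cover_zero_mem_cubeEnl_zero (by omega)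
  have hpX : p ∈ B8Eq17ClassAkV1.plaqsOf (s.Ω 1) := Or.inr (Or.inr (Or.inr hfar))
  -- the parameters (plain variables with defining equations — no `let`s, to keep `whnf` away from real-number definitions)
  obtain ⟨β, hβ⟩ : ∃ β : ℝ, β = max B₃ 1 := ⟨_, rfl⟩
  have hβ1 : 1 ≤ β := by rw [hβ]; exact le_max_right _ _
  have hβpos : 0 < β := by linarith only [hβ1]
  have hβB : B₃ ≤ β := by rw [hβ]; exact le_max_left _ _
  have hβL : β < 2 * (F.L : ℝ) ^ 2 := by rw [hβ]; exact max_lt hB (by linarith only [hL2ge])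
  obtain ⟨δS, hδS, hδSpos, hδS3⟩ : ∃ δS : ℝ, δS = deltaSU (Fin N) ∧ 0 < δS ∧ δS ≤ 1 / 3 :=
    ⟨_, rfl, deltaSU_pos, min_le_left _ _⟩
  obtain ⟨α₀, hα₀⟩ : ∃ α₀ : ℝ, α₀ = min (1 / 109824) (δS / (64 * (F.L : ℝ) ^ 2)) := ⟨_, rfl⟩
  have hα₀pos : 0 < α₀ := by rw [hα₀]; exact lt_min (by norm_num) (by positivity)
  have hα₀1 : α₀ ≤ 1 / 109824 := by rw [hα₀]; exact min_le_left _ _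
  have hα₀2 : α₀ ≤ δS / (64 * (F.L : ℝ) ^ 2) := by rw [hα₀]; exact min_le_right _ _
  obtain ⟨ε₀, hε₀⟩ : ∃ ε₀ : ℝ, ε₀ = min a₀ (α₀ / (2 * (F.L : ℝ) ^ 2)) := ⟨_, rfl⟩
  have hε₀pos : 0 < ε₀ := by rw [hε₀]; exact lt_min ha₀ (by positivity)
  have hε₀a₀ : ε₀ ≤ a₀ := by rw [hε₀]; exact min_le_left _ _
  have hε₀2 : ε₀ ≤ α₀ / (2 * (F.L : ℝ) ^ 2) := by rw [hε₀]; exact min_le_right _ _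
  have hε₀α : ε₀ < α₀ * P.eta 1 ^ 2 := by
    rw [show P.eta 1 ^ 2 = ((F.L : ℝ) ^ 2)⁻¹ from eta_one_sq (F := F) 1]
    calc ε₀ ≤ α₀ / (2 * (F.L : ℝ) ^ 2) := hε₀2
      _ < α₀ * ((F.L : ℝ) ^ 2)⁻¹ := by
          rw [div_eq_mul_inv, mul_inv, ← mul_assoc]
          have : α₀ * 2⁻¹ < α₀ := by linarith only [hα₀pos]
          exact mul_lt_mul_of_pos_right this (by positivity)
  have hε₀small : ε₀ ≤ 1 := by
    have h2 : α₀ / (2 * (F.L : ℝ) ^ 2) ≤ α₀ := div_le_self hα₀pos.le (by linarith only [hL2ge])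
    linarith only [hε₀2, h2, hα₀1]
  obtain ⟨C, hC⟩ : ∃ C : ℝ, C = 2 * N * (Fintype.card (Plaq P 0) : ℝ) + 1 := ⟨_, rfl⟩
  have hC0 : (0 : ℝ) ≤ 2 * N * (Fintype.card (Plaq P 0) : ℝ) := by positivity
  have hC1 : 1 ≤ C := by linarith only [hC, hC0]
  have hCpos : 0 < C := by linarith only [hC1]
  obtain ⟨δ₁, hδ₁⟩ : ∃ δ₁ : ℝ, δ₁ = min (a₁ / 2) (ε₀ * δS / (4 * β * C)) := ⟨_, rfl⟩
  have hδ₁pos : 0 < δ₁ := by rw [hδ₁]; exact lt_min (by linarith only [ha₁]) (by positivity)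
  have hδ₁a : δ₁ ≤ a₁ / 2 := by rw [hδ₁]; exact min_le_left _ _
  have hδ₁e : δ₁ ≤ ε₀ * δS / (4 * β * C) := by rw [hδ₁]; exact min_le_right _ _
  have hβδ₁ : β * δ₁ ≤ ε₀ * δS / (4 * C) := by
    calc β * δ₁ ≤ β * (ε₀ * δS / (4 * β * C)) := mul_le_mul_of_nonneg_left hδ₁e hβpos.le
      _ = ε₀ * δS / (4 * C) := by field_simp
  obtain ⟨t, ht⟩ : ∃ t : ℝ, t = β * δ₁ / (F.L : ℝ) ^ 2 := ⟨_, rfl⟩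
  have htpos : 0 < t := by rw [ht]; positivity
  -- `t ≤ ε₀ δS / (4 C L²)`: tiny
  have ht1 : t ≤ ε₀ * δS / (4 * C) / (F.L : ℝ) ^ 2 := by rw [ht]; exact div_le_div_of_nonneg_right hβδ₁ hL2pos.le
  have hsplit : ε₀ * δS / (4 * C) = ε₀ / C * (δS / 4) := by field_simp
  have hq1 : ε₀ * δS / (4 * C) ≤ ε₀ / C := by
    rw [hsplit]
    have : δS / 4 ≤ 1 := by linarith only [hδS3]
    exact (mul_le_mul_of_nonneg_left this (div_pos hε₀pos hCpos).le).trans_eq (mul_one _)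
  have hq2 : ε₀ / C ≤ ε₀ := div_le_self hε₀pos.le hC1
  have hq3 : ε₀ * δS / (4 * C) < ε₀ := by
    rw [hsplit]
    have h14 : δS / 4 < 1 := by linarith only [hδS3]
    have hεC : 0 < ε₀ / C := div_pos hε₀pos hCpos
    calc ε₀ / C * (δS / 4) < ε₀ / C * 1 := mul_lt_mul_of_pos_left h14 hεC
      _ = ε₀ / C := mul_one _
      _ ≤ ε₀ := hq2
  have htε : t < ε₀ / (F.L : ℝ) ^ 2 := ht1.trans_lt (div_lt_div_of_pos_right hq3 hL2pos)
  have htεL : t ≤ ε₀ / ((F.L : ℝ) ^ 2 * C) := by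
    refine ht1.trans ((div_le_div_of_nonneg_right hq1 hL2pos.le).trans_eq ?_)
    rw [div_div, mul_comm]
  have htδS : t < δS := by
    refine ht1.trans_lt ?_
    have h1 : ε₀ * δS / (4 * C) / (F.L : ℝ) ^ 2 ≤ ε₀ * δS / (4 * C) := div_le_self (by positivity) hL2ge
    refine h1.trans_lt ?_
    rw [hsplit]
    have hδ4 : 0 ≤ δS / 4 := by positivity
    calc ε₀ / C * (δS / 4) ≤ 1 * (δS / 4) := mul_le_mul_of_nonneg_right (hq2.trans hε₀small) hδ4
      _ < δS := by linarith only [hδSpos]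
  have ht12 : t ≤ 1 / 2 := by linarith only [htδS, hδS3]
  have ht1' : t < 1 := by linarith only [ht12]
  have ht2 : t ≤ 2 := by linarith only [ht12]
  have htδ₀ : t < 2 * δ₁ := by
    rw [ht, div_lt_iff₀ hL2pos]
    exact (mul_lt_mul_of_pos_right hβL hδ₁pos).trans_eq (by ring)
  have htB : B₃ * δ₁ / (F.L : ℝ) ^ 2 ≤ t := by
    rw [ht]; exact div_le_div_of_nonneg_right (mul_le_mul_of_nonneg_right hβB hδ₁pos.le) hL2pos.le
  -- the twist
  obtain ⟨g, hg⟩ := exists_su_dist1_eq (N := N) hN htpos.le ht2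
  set U₁ : GaugeField P 0 (Matrix.specialUnitaryGroup (Fin N) ℂ) := fun b => if b.src = x' ∧ b.dir = μ0 then g else 1 with hU₁
  set W : MSField P (Matrix.specialUnitaryGroup (Fin N) ℂ) := avgFamily (avOfRecord F N 1) U₁ with hW
  -- fine plaquettes of `U₁`
  have hμ0min : ∀ ν : Fin P.d, ¬ ν < μ0 := fun ν hν => Nat.not_lt_zero ν.val (Fin.lt_def.mp hν)
  have hU₁q : ∀ q : Plaq P 0, dist1 (GaugeField.plaqHol U₁ q) ≤ t := fun q => (dist1_plaqHol_single_le x' hμ0min g q).trans_eq hg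
  -- coarse bonds of `Ū₁`
  obtain ⟨τ, hτ⟩ : ∃ τ : ℝ, τ = Real.exp (1 / (F.L : ℝ) ^ 3 * (-Real.log (1 - t))) - 1 := ⟨_, rfl⟩
  have hτle : τ ≤ 4 * t / (F.L : ℝ) ^ 3 := by rw [hτ]; exact exp_log_ratio_le htpos.le ht12 hL1
  have hτ0 : 0 ≤ τ := by
    rw [hτ, sub_nonneg]
    refine Real.one_le_exp ?_
    have : 0 ≤ -Real.log (1 - t) := by
      rw [neg_nonneg]; exact Real.log_nonpos (by linarith only [ht1']) (by linarith only [htpos])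
    positivity
  have hcoarse : ∀ b : PBond P 1, dist1 (avgFun expMeanLogSU U₁ b) ≤ τ := by
    intro b
    by_cases hb : b = ⟨y₁, μ0⟩
    · rw [hb, hτ]
      have hmain := dist1_avgFun_single_star_le (N := N) hper2 hL3 hne y₁ x' g hx0 hxκ hg.le (hδS ▸ htδS) ht1'
      have h3 : (P.L : ℝ) ^ (P.d - 1) = (F.L : ℝ) ^ 3 := by rw [hPL, hPd]
      rw [h3] at hmain
      exact hmain
    · rw [avgFun_single_eq_one_of_ne_star expMeanLogSU expMeanLogSU_E_one hj hper2 y₁ x' g hx0 hxκ b hb, GaugeGroup.dist1_one]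
      exact hτ0
  have htL : t * (F.L : ℝ) ^ 2 = β * δ₁ := by rw [ht]; field_simp
  have h16t : 16 * t < δ₁ * (F.L : ℝ) ^ 3 := by
    have hβδL : β * δ₁ < 2 * (F.L : ℝ) ^ 2 * δ₁ := mul_lt_mul_of_pos_right hβL hδ₁pos
    have h32 : 32 * ((F.L : ℝ) ^ 2 * δ₁) ≤ (F.L : ℝ) ^ 3 * ((F.L : ℝ) ^ 2 * δ₁) :=
      mul_le_mul_of_nonneg_right hL3ge (by positivity)
    have hmul : 16 * t * (F.L : ℝ) ^ 2 < δ₁ * (F.L : ℝ) ^ 3 * (F.L : ℝ) ^ 2 := by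
      calc 16 * t * (F.L : ℝ) ^ 2 = 16 * (β * δ₁) := by rw [mul_assoc, htL]
        _ < 16 * (2 * (F.L : ℝ) ^ 2 * δ₁) := by linarith only [hβδL]
        _ = 32 * ((F.L : ℝ) ^ 2 * δ₁) := by ring
        _ ≤ (F.L : ℝ) ^ 3 * ((F.L : ℝ) ^ 2 * δ₁) := h32
        _ = δ₁ * (F.L : ℝ) ^ 3 * (F.L : ℝ) ^ 2 := by ring
    exact lt_of_mul_lt_mul_right hmul hL2pos.le
  have hcoarseq : ∀ q : Plaq P 1, dist1 (GaugeField.plaqHol (avgFun expMeanLogSU U₁) q) < δ₁ := by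
    intro q
    refine (dist1_plaqHol_le_four_mul hcoarse q).trans_lt ?_
    calc 4 * τ ≤ 4 * (4 * t / (F.L : ℝ) ^ 3) := by linarith only [hτle]
      _ = 16 * t / (F.L : ℝ) ^ 3 := by ring
      _ < δ₁ := by rw [div_lt_iff₀ hL3pos]; exact h16t
  -- the thresholds
  set δ : ℕ → ℝ := fun n => if n = 0 then 2 * δ₁ else δ₁ with hδdef
  have hδ0 : δ 0 = 2 * δ₁ := if_pos rfl
  have hδ1 : δ 1 = δ₁ := if_neg one_ne_zero
  have hδ : ∀ n, n ≤ 1 → 0 < δ n ∧ δ n ≤ a₁ ∧ B₃ * δ n ≤ ε₀ := by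
    have hBε : B₃ * (2 * δ₁) ≤ ε₀ := by
      rcases le_or_gt B₃ 0 with hB0 | hB0
      · exact (mul_nonpos_iff.mpr (Or.inr ⟨hB0, by linarith only [hδ₁pos]⟩)).trans hε₀pos.le
      · calc B₃ * (2 * δ₁) ≤ β * (2 * δ₁) := mul_le_mul_of_nonneg_right hβB (by linarith only [hδ₁pos])
          _ = 2 * (β * δ₁) := by ring
          _ ≤ 2 * (ε₀ * δS / (4 * C)) := by linarith only [hβδ₁]
          _ = ε₀ / C * (δS / 2) := by rw [hsplit]; ring
          _ ≤ ε₀ * 1 :=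
              mul_le_mul hq2 (by linarith only [hδS3]) (by linarith only [hδSpos]) hε₀pos.le
          _ = ε₀ := mul_one _
    have hBε1 : B₃ * δ₁ ≤ ε₀ := by
      rcases le_or_gt B₃ 0 with hB0 | hB0
      · exact (mul_nonpos_iff.mpr (Or.inr ⟨hB0, hδ₁pos.le⟩)).trans hε₀pos.le
      · exact (mul_le_mul_of_nonneg_left (by linarith only [hδ₁pos] : δ₁ ≤ 2 * δ₁) hB0.le).trans hBε
    have h2δa : 2 * δ₁ ≤ a₁ := by linarith only [hδ₁a]
    have hδa : δ₁ ≤ a₁ := by linarith only [hδ₁a, hδ₁pos]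
    have h2δpos : 0 < 2 * δ₁ := by linarith only [hδ₁pos]
    intro n hn
    rcases Nat.le_one_iff_eq_zero_or_eq_one.mp hn with rfl | rfl
    · rw [hδ0]; exact ⟨h2δpos, h2δa, hBε⟩
    · rw [hδ1]; exact ⟨hδ₁pos, hδa, hBε1⟩
  have hcomp : ∀ n, n < 1 → δ n ≤ 2 * δ (n + 1) := by
    intro n hn
    have hn0 : n = 0 := by omega
    subst hn0
    rw [hδ0, hδ1]
  -- (7) on its printed range for `W = M_𝐁(U₁)`
  have h7 : Sect2.DataSmall7P (avOfRecord F N 1) s.Ω 1 δ W := by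
    refine ⟨fun q _ => ?_, fun m hm q _ => ?_⟩
    · rw [hδ0]
      exact (hU₁q q).trans_lt htδ₀
    · have hm0 : m = 0 := by omega
      subst hm0
      rw [hδ1]
      show dist1 (GaugeField.plaqHol (Sect2.mixedField (avOfRecord F N 1) (genSet s.Ω 1 (0 + 1))
        ((avOfRecord F N 1 0).avg U₁) U₁) q) < δ₁
      rw [mixedField_avg_self, avOfRecord_avg]
      exact hcoarseq q
  -- `U₁` lies in the `ε₀`-class with small action
  have hU₁cls : ∀ n, n ≤ 1 → PlaqSmallOn (omegaPlaqs s.Ω n) (ε₀ * P.eta n ^ 2) U₁ := by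
    intro n hn q _
    refine (hU₁q q).trans_lt (htε.trans_le ?_)
    rcases Nat.le_one_iff_eq_zero_or_eq_one.mp hn with rfl | rfl
    · simp only [Params.eta, pow_zero, one_pow, mul_one]
      exact div_le_self hε₀pos.le hL2ge
    · rw [show P.eta 1 ^ 2 = ((F.L : ℝ) ^ 2)⁻¹ from eta_one_sq (F := F) 1, div_eq_mul_inv]
  have hA : AgreeOn (genSet s.Ω 1) (avgFamily (avOfRecord F N 1) U₁) W := fun _ _ _ => rfl
  have hact : 2 * N * wilsonAction4 U₁ < (ε₀ * P.eta 1 ^ 2) ^ 2 := by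
    have hAle := wilsonAction4_le_card_mul_sq hU₁q
    rw [show P.eta 1 ^ 2 = ((F.L : ℝ) ^ 2)⁻¹ from eta_one_sq (F := F) 1]
    have hN0 : (0 : ℝ) ≤ 2 * N := by positivity
    calc 2 * N * wilsonAction4 U₁ ≤ 2 * N * ((Fintype.card (Plaq P 0) : ℝ) * t ^ 2) := mul_le_mul_of_nonneg_left hAle hN0
      _ = (C - 1) * t ^ 2 := by rw [hC]; ring
      _ < C * t ^ 2 := by
          have h' : (C - 1) * t ^ 2 = C * t ^ 2 - t ^ 2 := by ring
          rw [h']; linarith only [pow_pos htpos 2]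
      _ = (C * t) * t := by ring
      _ ≤ (ε₀ / (F.L : ℝ) ^ 2) * (ε₀ / (F.L : ℝ) ^ 2) := by
          apply mul_le_mul _ htε.le htpos.le (by positivity)
          calc C * t ≤ C * (ε₀ / ((F.L : ℝ) ^ 2 * C)) := mul_le_mul_of_nonneg_left htεL hCpos.le
            _ = ε₀ / (F.L : ℝ) ^ 2 := by field_simp
      _ = (ε₀ * ((F.L : ℝ) ^ 2)⁻¹) ^ 2 := by rw [div_eq_mul_inv]; ring
  have hα3 : (143 * ((((P.d + 4 : ℕ) : ℝ)) ^ 2 / 4) ^ 2) * α₀ ≤ 1 / 3 := by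
    rw [hPd]; norm_num
    linarith only [hα₀1]
  have hα2 : 2 * α₀ ≤ 2 * deltaSU (Fin N) / (((P.d + 4) * P.L : ℕ) : ℝ) ^ 2 := by
    have h64 : (((P.d + 4) * P.L : ℕ) : ℝ) ^ 2 = 64 * (F.L : ℝ) ^ 2 := by
      rw [hPd, hPL]; push_cast; ring
    rw [h64, mul_div_assoc, ← hδS]
    linarith only [hα₀2]
  obtain ⟨U₀, hmin⟩ := exists_isMinimizer_holes_of_smallAction F 1 1 s.Ω hα₀pos hα3 hα2 hε₀pos.le hε₀α hU₁cls hA hact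
  -- the fact bounds the corner plaquette of `U₀` …
  have hp1 : p ∈ omegaPlaqs s.Ω 1 := by rw [omegaPlaqs_of_ne_zero s.Ω one_ne_zero]; exact hpX
  have hbound := h numerics7OfRecord₁₂ 1 (fun _ => (1 : ℝ)) 1 1 s hsep ε₀ δ hδ hcomp hε₀a₀ W h7 U₀ hmin 1 le_rfl p hp1
  -- … which is pinned to `U₁`'s value `g⁻¹`
  obtain ⟨hb1, hb2, hb3, hb4⟩ := cornerPlaq_bonds_mem_bondsOf one_pos s.Ω p h1 h2 h3
  have hpin : GaugeField.plaqHol U₀ p = g⁻¹ := by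
    rw [plaqHol_eq_of_agreeOn_of_bonds (avOfRecord F N 1) hmin.2.1 p hb1 hb2 hb3 hb4]
    exact plaqHol_single_corner p g
  rw [hpin, GaugeGroup.dist1_inv, hg, hδ1, show P.eta 1 ^ 2 = ((F.L : ℝ) ^ 2)⁻¹ from eta_one_sq (F := F) 1] at hbound
  have : t < B₃ * δ₁ / (F.L : ℝ) ^ 2 := by rw [div_eq_mul_inv]; exact hbound
  linarith only [this, htB]

/-- Hence `¬ VariationalThm1RegSepPrinted F N B₃ a₀ a₁` for every `B₃ < 2L²` (`N ≥ 2`, `0 < a₀`, `0 < a₁`). [cite: Balaban1985Variational, Thm 1 (7)–(8) pp.278–279 (bookkeeping)] -/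
theorem not_variationalThm1RegSepPrinted_of_lt_two_sq (hN : 2 ≤ N) {B₃ a₀ a₁ : ℝ} (ha₀ : 0 < a₀) (ha₁ : 0 < a₁)
    (hB : B₃ < 2 * (F.L : ℝ) ^ 2) : ¬ VariationalThm1RegSepPrinted F N B₃ a₀ a₁ :=
  fun h => absurd (two_sq_L_le_of_variationalThm1RegSepPrinted hN ha₀ ha₁ h) (not_le.mpr hB)

end Floor

/-! ## §9  Truth set below the floor -/
section CorollariesD

variable {F : T4Family} {N : ℕ} [NeZero N]

/-- Truth set of FILE 8 v1.3's fact below the floor: for `B₃ < 2L²` it holds only in the degenerate corner `a₀ ≤ 0 ∨ a₁ ≤ 0`. [cite: Balaban1985Variational, Thm 1 (7)–(8) pp.278–279 (bookkeeping)] -/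
theorem variationalThm1RegSepPrinted_degenerate_of_lt_two_sq (hN : 2 ≤ N) {B₃ a₀ a₁ : ℝ} (hB : B₃ < 2 * (F.L : ℝ) ^ 2)
    (h : VariationalThm1RegSepPrinted F N B₃ a₀ a₁) : a₀ ≤ 0 ∨ a₁ ≤ 0 := by
  by_contra hne
  push Not at hne
  exact not_variationalThm1RegSepPrinted_of_lt_two_sq hN hne.1 hne.2 hB h

end CorollariesD

end Summit.QuantumFields.YangMills.Theorems.K0AveragedSingleBondFloor

end
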